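import Summits.AtomisticToContinuum.HydrodynamicLimit.Theses.CollisionIsometryCLT

/-!
# Sketch — crux-ideate stmt-AtomisticToContinuum-12949 (`CollisionIsometryCLT.AdaptedWeightCLT`), ideator 2, round 1

First lemmas for two crux idea cards:

* Card A `contact-source-duhamel` : the exact one-collision VARIATION-OF-CONSTANTS identity for the
  one-particle second-moment tensor (`collision_source_identity`): at a collision `(i, j, ω)` the tensor
  `y_i' ⊗ y_i'` equals the "diagonal transport" `Pᶜ(y_i⊗y_i)Pᶜ + P(y_j⊗y_j)P` plus the trace-free
  pre-collisional CROSS source `Pᶜ y_i ⊗ P y_j + h.c.` (`P = ω⊗ω`), tested against arbitrary `a, b`;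
  and the Hilbert–Schmidt conjugation invariance `‖Mᵀ B M‖_F = ‖B‖_F` for orthogonal `M`
  (`frobenius_conj`), which makes cell concentration free of the transfer.
* Card B `impulse-stress-contraction` : the exact per-collision update of the PAIR stress
  (`pair_stress_update`) `Δ(y_i⊗y_i + y_j⊗y_j) = -p (g_⊥⊗ω + ω⊗g_⊥)`, `p = ⟪y_i - y_j, ω⟫`,
  `g_⊥ = (y_i - y_j) - p•ω` — the identity whose spherical average gives
  `E Δ‖J - I/3‖² = -(4/5) gᵀ(J - I/3)g + (4/15)|g|⁴` (source = column ipr); the spin-1 suppression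
  inequality (`spin_one_suppression`) by which H1 (ipr → 0) kills the fully diagonal heat-flux term;
  and the TYPED sibling hypothesis `ColumnDepolarisation` over the crux's own `let M` block.
-/

namespace Summit.AtomisticToContinuum.HydrodynamicLimit.Cruxes.AdaptedWeightCLT.IdeatorTwo

open scoped BigOperators Topology RealInnerProductSpace Matrix
open Filter Set MeasureTheory

section Algebra

variable {E : Type*} [NormedAddCommGroup E] [InnerProductSpace ℝ E]

/-- **Card A, first lemma (variation of constants at one collision).** With `p = ⟪y_i - y_j, ω⟫`
and the post-collisional velocity `y_i' = y_i - p • ω`, the rank-one tensor `y_i' ⊗ y_i'`, tested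
against `a ⊗ b`, splits EXACTLY into the diagonal transport of `y_i ⊗ y_i` (complementary
projection on both sides) and of `y_j ⊗ y_j` (projection on `ω` on both sides) plus the two
pre-collisional cross terms `Pᶜy_i ⊗ Py_j`, `Py_j ⊗ Pᶜy_i`. No normalisation of `ω` is needed
for the formal identity (`‖ω‖ = 1` only interprets `P` as a projection). [folklore] -/
theorem collision_source_identity (yi yj ω a b : E) :
    ⟪a, yi - ⟪yi - yj, ω⟫ • ω⟫ * ⟪b, yi - ⟪yi - yj, ω⟫ • ω⟫ =
      (⟪a, yi⟫ - ⟪a, ω⟫ * ⟪yi, ω⟫) * (⟪b, yi⟫ - ⟪b, ω⟫ * ⟪yi, ω⟫)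
      + (⟪a, ω⟫ * ⟪yj, ω⟫) * (⟪b, ω⟫ * ⟪yj, ω⟫)
      + (⟪a, yi⟫ - ⟪a, ω⟫ * ⟪yi, ω⟫) * (⟪b, ω⟫ * ⟪yj, ω⟫)
      + (⟪a, ω⟫ * ⟪yj, ω⟫) * (⟪b, yi⟫ - ⟪b, ω⟫ * ⟪yi, ω⟫) := by
  simp only [inner_sub_right, real_inner_smul_right, inner_sub_left]
  ring

/-- **Card B, first lemma (pair stress update).** With `p = ⟪y_i - y_j, ω⟫`,
`y_i' = y_i - p•ω`, `y_j' = y_j + p•ω` and `g_⊥ = (y_i - y_j) - p•ω`, the pair stress changes by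
`-p (g_⊥ ⊗ ω + ω ⊗ g_⊥)` (tested against `a ⊗ b`); formally valid for every `ω`. [folklore] -/
theorem pair_stress_update (yi yj ω a b : E) :
    let p : ℝ := ⟪yi - yj, ω⟫
    ⟪a, yi - p • ω⟫ * ⟪b, yi - p • ω⟫ + ⟪a, yj + p • ω⟫ * ⟪b, yj + p • ω⟫
      - (⟪a, yi⟫ * ⟪b, yi⟫ + ⟪a, yj⟫ * ⟪b, yj⟫) =
      -p * (⟪a, (yi - yj) - p • ω⟫ * ⟪b, ω⟫ + ⟪a, ω⟫ * ⟪b, (yi - yj) - p • ω⟫) := by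
  simp only [inner_sub_right, inner_add_right, real_inner_smul_right, inner_sub_left]
  ring

/-- **Energy bookkeeping of the update** (trace of `pair_stress_update` with `a = b` summed over an
orthonormal basis is zero): for a UNIT normal the pair kinetic energy is conserved. [folklore] -/
theorem pair_energy_conserved (yi yj ω : E) (hω : ‖ω‖ = 1) :
    let p : ℝ := ⟪yi - yj, ω⟫
    ‖yi - p • ω‖ ^ 2 + ‖yj + p • ω‖ ^ 2 = ‖yi‖ ^ 2 + ‖yj‖ ^ 2 := by
  intro p
  have hωω : ⟪ω, ω⟫ = 1 := by rw [real_inner_self_eq_norm_sq, hω, one_pow]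
  have h1 : ‖yi - p • ω‖ ^ 2 = ‖yi‖ ^ 2 - 2 * p * ⟪yi, ω⟫ + p ^ 2 := by
    rw [@norm_sub_sq_real, norm_smul, Real.norm_eq_abs, hω, mul_one, sq_abs, real_inner_smul_right]
    ring
  have h2 : ‖yj + p • ω‖ ^ 2 = ‖yj‖ ^ 2 + 2 * p * ⟪yj, ω⟫ + p ^ 2 := by
    rw [@norm_add_sq_real, norm_smul, Real.norm_eq_abs, hω, mul_one, sq_abs, real_inner_smul_right]
    ring
  have hp : p = ⟪yi, ω⟫ - ⟪yj, ω⟫ := inner_sub_left _ _ _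
  rw [h1, h2, hp]
  ring

/-- **Spin-1 suppression (how H1 kills the fully diagonal heat-flux term).** The energy-weighted
momentum of an impulse cloud `{m_i}` in a unit direction is at most `(sup ‖m_i‖)·(Σ‖m_i‖²)`; with
`Σ‖m_i‖² = ‖y‖²` and `sup ‖m_i‖ ≤ (Σ‖m_i‖⁴)^{1/4}` this is the column participation bound.
[folklore] -/
theorem spin_one_suppression {ι : Type*} (s : Finset ι) (m : ι → E) (a : E) (B : ℝ)
    (hB : ∀ i ∈ s, ‖m i‖ ≤ B) (ha : ‖a‖ ≤ 1) :
    |∑ i ∈ s, ‖m i‖ ^ 2 * ⟪m i, a⟫| ≤ B * ∑ i ∈ s, ‖m i‖ ^ 2 := by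
  calc |∑ i ∈ s, ‖m i‖ ^ 2 * ⟪m i, a⟫|
      ≤ ∑ i ∈ s, |‖m i‖ ^ 2 * ⟪m i, a⟫| := Finset.abs_sum_le_sum_abs _ _
    _ ≤ ∑ i ∈ s, B * ‖m i‖ ^ 2 := by
        refine Finset.sum_le_sum fun i hi => ?_
        rw [abs_mul, abs_of_nonneg (sq_nonneg _)]
        have h1 : |⟪m i, a⟫| ≤ ‖m i‖ * ‖a‖ := abs_real_inner_le_norm _ _
        have h2 : ‖m i‖ * ‖a‖ ≤ B := by
          calc ‖m i‖ * ‖a‖ ≤ ‖m i‖ * 1 :=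
                mul_le_mul_of_nonneg_left ha (norm_nonneg _)
            _ ≤ B := by rw [mul_one]; exact hB i hi
        calc ‖m i‖ ^ 2 * |⟪m i, a⟫| ≤ ‖m i‖ ^ 2 * B :=
              mul_le_mul_of_nonneg_left (h1.trans h2) (sq_nonneg _)
          _ = B * ‖m i‖ ^ 2 := mul_comm _ _
    _ = B * ∑ i ∈ s, ‖m i‖ ^ 2 := (Finset.mul_sum _ _ _).symm

end Algebra

section Frobenius

variable {n : Type*} [Fintype n] [DecidableEq n]

/-- **Hilbert–Schmidt conjugation invariance.** For an orthogonal matrix `M` (`Mᵀ M = 1`) and any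
`B`, `tr((MᵀBM)ᵀ(MᵀBM)) = tr(BᵀB)`: the block-test kernel `Q = Mᵀ(φ⊗C)M` of Card A has the SAME
Frobenius norm `‖C‖_F (Σφ_i²)^{1/2}` as the block-diagonal form it conjugates, whatever the transfer.
[folklore] -/
theorem frobenius_conj (M B : Matrix n n ℝ) (hM : Mᵀ * M = 1) :
    Matrix.trace ((Mᵀ * B * M)ᵀ * (Mᵀ * B * M)) = Matrix.trace (Bᵀ * B) := by
  have hM' : M * Mᵀ = 1 := mul_eq_one_comm.mp hM
  have h1 : (Mᵀ * B * M)ᵀ * (Mᵀ * B * M) = Mᵀ * (Bᵀ * B) * M := by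
    rw [Matrix.transpose_mul, Matrix.transpose_mul, Matrix.transpose_transpose]
    simp only [Matrix.mul_assoc]
    rw [← Matrix.mul_assoc M (Mᵀ), hM', Matrix.one_mul]
  rw [h1, Matrix.trace_mul_cycle, hM', Matrix.one_mul]

end Frobenius

section Typed

/-- **TYPED sibling hypothesis `ColumnDepolarisation` (Card B's target; Card A's input).** Same
prefix and the same `let M` (frozen-geometry transfer of the Alexander construction) as the crux
`CollisionIsometryCLT.AdaptedWeightCLT`; the functional is the mean over injection sites `k` and
coordinate directions `a` of the squared Frobenius distance between the FORWARD impulse stress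
`J_{k,a} = Σ_i (M e_{k,a})_i ⊗ (M e_{k,a})_i` (trace `1` by `TransferIsometry`) and the isotropic
tensor `I/3`; it lies in `[0, 2/3]`. Statement: for every admissible window and every `t > 0` its
local-Gibbs expectation over the window `[t - Δ_N, t]` tends to `0`. -/
def ColumnDepolarisation : Prop :=
  ∀ (a₀ θ₀ : (UnitAddTorus (Fin 3)) → ℝ) (u₀ : (UnitAddTorus (Fin 3)) → (EuclideanSpace ℝ (Fin 3))), Continuous a₀ → Continuous θ₀ → Continuous u₀ → (∀ x, 0 < a₀ x) → (∀ x, 0 < θ₀ x) → ∃ σ₀ : ℝ, 0 < σ₀ ∧ ∀ σ : ℝ, 0 < σ → σ < σ₀ → let M := fun (N : ℕ) (y : Literature.Analysis.FluidPDE.Config (N + 1) (Fin 3) (UnitAddTorus (Fin 3))) (Δ : ℝ) (W : Fin (N + 1) → EuclideanSpace ℝ (Fin 3)) => (let G := Literature.Analysis.FluidPDE.Torus.geometry (Fin 3); let ε : ℝ := Literature.MathematicalPhysics.KineticTheory.hsDiameter σ N; let pre := fun k : ℕ => (let zk := Literature.Analysis.FluidPDE.Alexander.stateAfter G ε y k;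 Literature.Analysis.FluidPDE.freeFlight G (Literature.Analysis.FluidPDE.Alexander.freeExitTime G ε zk).toReal zk); (List.range (Literature.Analysis.FluidPDE.Alexander.collisionCount G ε y Δ)).foldl (fun W' k => @dite (Fin (N + 1) → EuclideanSpace ℝ (Fin 3)) (Literature.Analysis.FluidPDE.Alexander.incomingPairs G ε (pre k)).Nonempty (Classical.propDecidable _) (fun h => fun i => (Literature.Analysis.FluidPDE.collidePair G h.some.1 h.some.2 (fun j => ((pre k j).1, W' j)) i).2) (fun _ => W')) W); let cdp := fun N y Δ => ((N + 1 : ℕ) : ℝ)⁻¹ * ∑ k : Fin (N + 1), ∑ a : Fin 3, ∑ p : Fin 3, ∑ q : Fin 3, ((∑ i : Fin (N + 1), (M N y Δ (Pi.single k (EuclideanSpace.single a (1 : ℝ))) i) p * (M N y Δ (Pi.single k (EuclideanSpace.single a (1 : ℝ))) i) q) - (if p = q then (1 : ℝ) / 3 else 0)) ^ 2; ∀ Φ : (N : ℕ) → Literature.Analysis.FluidPDE.HardSphereFlow (Literature.Analysis.FluidPDE.Torus.geometry (Fin 3)) (Literature.MathematicalPhysics.KineticTheory.hsDiameter σ N)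 (N + 1), ∀ Δ : ℕ → ℝ, (∀ N, 0 < Δ N) → Tendsto Δ atTop (𝓝 0) → Tendsto (fun N : ℕ => Δ N * ((N + 1 : ℕ) : ℝ) ^ ((1 : ℝ) / 3)) atTop atTop → ∀ t : ℝ, 0 < t → Tendsto (fun N : ℕ => ∫⁻ z, ENNReal.ofReal (cdp N ((Φ N).flow (t - Δ N) z) (Δ N)) ∂(Literature.MathematicalPhysics.KineticTheory.localGibbsLaw σ a₀ u₀ θ₀ N (Φ N))) atTop (𝓝 0)

/-- **TYPED `IncoherentColumnDepolarisation` (the form Card A's Duhamel identity consumes).** Along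
the same Alexander collision sequence as the crux's `let M`, propagate a family of symmetric `3×3`
tensors `T : Fin (N+1) → Matrix (Fin 3) (Fin 3) ℝ` by the INCOHERENT (decoupled-square) step
`T_i ↦ PᶜT_iPᶜ + P T_j P`, `T_j ↦ PᶜT_jPᶜ + P T_i P`, `P = n nᵀ/‖n‖²`, `n = G.sepVec x_i x_j` the
pre-collisional separation (the same direction `collidePair`/`reflectVel` use; identity at `n = 0`
by the junk value `‖0‖⁻¹ = 0`, matching `reflectVel_zero`). Starting from the single-site family
`e_a e_aᵀ` at `k`, the propagated family sums to the incoherent impulse stress `J^𝒟_{k,a}`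
(trace `1`); the statement asks its mean squared distance to `I/3` to vanish in local-Gibbs mean
on every admissible window. On forest windows `J^𝒟 = J` of `ColumnDepolarisation`. -/
def IncoherentColumnDepolarisation : Prop :=
  ∀ (a₀ θ₀ : (UnitAddTorus (Fin 3)) → ℝ) (u₀ : (UnitAddTorus (Fin 3)) → (EuclideanSpace ℝ (Fin 3))), Continuous a₀ → Continuous θ₀ → Continuous u₀ → (∀ x, 0 < a₀ x) → (∀ x, 0 < θ₀ x) → ∃ σ₀ : ℝ, 0 < σ₀ ∧ ∀ σ : ℝ, 0 < σ → σ < σ₀ → let D := fun (N : ℕ) (y : Literature.Analysis.FluidPDE.Config (N + 1) (Fin 3) (UnitAddTorus (Fin 3))) (Δ : ℝ) (T : Fin (N + 1) → Matrix (Fin 3) (Fin 3) ℝ) => (let G := Literature.Analysis.FluidPDE.Torus.geometry (Fin 3); let ε : ℝ := Literature.MathematicalPhysics.KineticTheory.hsDiameter σ N; let pre := fun k : ℕ => (let zk := Literature.Analysis.FluidPDE.Alexander.stateAfter G ε y k; Literature.Analysis.FluidPDE.freeFlight G (Literature.Analysis.FluidPDE.Alexander.freeExitTime G ε zk).toReal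 zk); (List.range (Literature.Analysis.FluidPDE.Alexander.collisionCount G ε y Δ)).foldl (fun T' k => @dite (Fin (N + 1) → Matrix (Fin 3) (Fin 3) ℝ) (Literature.Analysis.FluidPDE.Alexander.incomingPairs G ε (pre k)).Nonempty (Classical.propDecidable _) (fun h => let i := h.some.1; let j := h.some.2; let n : EuclideanSpace ℝ (Fin 3) := G.sepVec (pre k i).1 (pre k j).1; let P : Matrix (Fin 3) (Fin 3) ℝ := (‖n‖ ^ 2)⁻¹ • Matrix.vecMulVec (fun p => n p) (fun q => n q); let Pc : Matrix (Fin 3) (Fin 3) ℝ := 1 - P; Function.update (Function.update T' i (Pc * T' i * Pc + P * T' j * P)) j (Pc * T' j * Pc + P * T' i * P)) (fun _ => T')) T); let icdp := fun N y Δ => ((N + 1 : ℕ) : ℝ)⁻¹ * ∑ k : Fin (N + 1), ∑ a : Fin 3, ∑ p : Fin 3, ∑ q : Fin 3, ((∑ i : Fin (N + 1), D N y Δ (Function.update (fun _ => (0 : Matrix (Fin 3) (Fin 3) ℝ)) k (Matrix.vecMulVec (Pi.single a (1 : ℝ)) (Pi.single a (1 : ℝ)))) i p q) - (if p = q then (1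 : ℝ) / 3 else 0)) ^ 2; ∀ Φ : (N : ℕ) → Literature.Analysis.FluidPDE.HardSphereFlow (Literature.Analysis.FluidPDE.Torus.geometry (Fin 3)) (Literature.MathematicalPhysics.KineticTheory.hsDiameter σ N) (N + 1), ∀ Δ : ℕ → ℝ, (∀ N, 0 < Δ N) → Tendsto Δ atTop (𝓝 0) → Tendsto (fun N : ℕ => Δ N * ((N + 1 : ℕ) : ℝ) ^ ((1 : ℝ) / 3)) atTop atTop → ∀ t : ℝ, 0 < t → Tendsto (fun N : ℕ => ∫⁻ z, ENNReal.ofReal (icdp N ((Φ N).flow (t - Δ N) z) (Δ N)) ∂(Literature.MathematicalPhysics.KineticTheory.localGibbsLaw σ a₀ u₀ θ₀ N (Φ N))) atTop (𝓝 0)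

/-- The restated crux Card A proposes for crux-plan (informational; the crux itself is FIXED):
`ColumnDepolarisation` as an extra antecedent in front of the crux's own hypotheses. The line's
skeleton would prove `ColumnDepolarisation → AdaptedWeightCLT` through the contact-source
decomposition, and Card B discharges `ColumnDepolarisation` from `DiffuseBackwardInfluence` plus a
one-step normal non-degeneracy. -/
def AdaptedWeightCLTGivenCD : Prop :=
  IncoherentColumnDepolarisation → Summit.AtomisticToContinuum.HydrodynamicLimit.Theses.CollisionIsometryCLT.AdaptedWeightCLT

end Typed

end Summit.AtomisticToContinuum.HydrodynamicLimit.Cruxes.AdaptedWeightCLT.IdeatorTwo
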